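import Literature.Probability.Percolation.Percolation
import HarnessLib

/-!
# Connectivity correlation inequalities for `φ_{w,q}`, every `q > 0` — file 9 (DEFINITION): two-terminal series–parallel networks

Definitions file (`--supports stmt-CriticalPhenomena-4575`), FK sub-lane `prim-bschramm-fk-2` (gen 7) of the post-continuity
programme; builds on p205010 (kernel theorem, internal audit signed; external expert review pending).  No named facts, no sorries,
nothing probabilistic: this file only fixes the SYNTAX of the class of supports on which the sibling files
`…FKConnectivityAllQSPGluing.lean` / `…SPLaw.lean` / `…SPMono.lean` / `…SPWagner.lean` prove, for EVERY `q > 0`, the positive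
correlation of the two-point connection event of the terminals with every edge event under the random-cluster measure
`φ_{𝐩,q}` (Grimmett 2006, eq. (1.20)) — hence, for `0 < q < 1`, edge-negative association (Wagner 2008, graph case of
Thm. 5.8(d): series–parallel graphs are Potts–Rayleigh for all `0 < q ≤ 1`) and Ayyer–Linusson–Ravichandran's hub inequality (13),
unconditionally on this class (the sibling `…AllQSeriesParallel.lean` obtains them on all `K₄`-minor-free supports CONDITIONALLY on the
named fact `Wagner2008_rc_edgeNegCorr_of_noK4Minor`; the two classes agree by Duffin's structure theorem, which is not in the tree).

* `FK.IsTTSP E s t` — the edge set `E : Finset (Sym2 V)` is a TWO-TERMINAL SERIES–PARALLEL NETWORK with terminals `s ≠ t`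
  (Duffin 1965; Riordan–Shannon 1942 / Moore–Shannon 1956): the least class containing the single edges `{s(s, t)}` (`s ≠ t`) and
  closed under SERIES composition (an `(a, m)`-network and an `(m, b)`-network, edge-disjoint, whose spanned vertex sets meet only
  in the middle terminal `m`, with `a` off the second part and `b` off the first) and PARALLEL composition (two edge-disjoint
  `(s, t)`-networks whose spanned vertex sets meet only inside `{s, t}`).  The side conditions are literally the vertex-separator
  hypotheses of the gluing lemmas (`GZGluing.walk_split`, `clusterCount_union_add_eq`) with `Vᵢ :=` the vertex set spanned by `Eᵢ`,
  written inline as `{z | ∃ e ∈ Eᵢ, z ∈ e}` (same design as the hub networks `GZSP.IsSPNet` of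
  `PercNearOneGluingNoHeavyLowerTailGZSPDefs.lean`, without hub edges).  Pairs are `Sym2 V` (simple graphs: a parallel pair of
  edges is one pair with the combined parameter), so "parallel composition" of two copies of the same single edge does not occur
  (the parts are disjoint).
(Pattern: Duffin 1965, Thm. 1: a finite 2-connected multigraph with a distinguished edge `st` has no `K₄` minor iff deleting `st`
leaves a two-terminal series–parallel network between `s` and `t`; not used and not claimed in Lean.)
[cite: Grimmett2006, §1.4 eq. (1.20) (p. 15); §3.9 (pp. 63–64)] [cite: Wagner2006, Thm. 5.8(d), §5.3]
-/

namespace Summit.CriticalPhenomena.PercolationContinuityZ3.Theorems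

namespace FK

open scoped Classical

variable {V : Type*}

/-- **Two-terminal series–parallel network** `IsTTSP E s t` (edge set `E`, terminals `s`, `t`): the least class of finite edge
sets containing the single edges `{s(s, t)}` with `s ≠ t` and closed under SERIES composition at a middle terminal `m`
(edge-disjoint parts whose spanned vertex sets meet only in `m`, the far terminal of each part off the other part) and PARALLEL
composition (edge-disjoint parts with the same terminals whose spanned vertex sets meet only inside `{s, t}`)
(Duffin 1965; Moore–Shannon 1956). [folklore] -/
inductive IsTTSP : Finset (Sym2 V) → V → V → Prop
  /-- the single edge `st`, `s ≠ t` -/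
  | edge {s t : V} (hst : s ≠ t) : IsTTSP {s(s, t)} s t
  /-- series composition of an `(a, m)`-network and an `(m, b)`-network at the middle terminal `m` -/
  | series {E₁ E₂ : Finset (Sym2 V)} {a m b : V} (h₁ : IsTTSP E₁ a m) (h₂ : IsTTSP E₂ m b)
      (hd : Disjoint E₁ E₂) (hV : ∀ z : V, (∃ e ∈ E₁, z ∈ e) → (∃ e ∈ E₂, z ∈ e) → z = m)
      (ha : ∀ e ∈ E₂, a ∉ e) (hb : ∀ e ∈ E₁, b ∉ e) : IsTTSP (E₁ ∪ E₂) a b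
  /-- parallel composition of two `(s, t)`-networks -/
  | parallel {E₁ E₂ : Finset (Sym2 V)} {s t : V} (h₁ : IsTTSP E₁ s t) (h₂ : IsTTSP E₂ s t)
      (hd : Disjoint E₁ E₂) (hV : ∀ z : V, (∃ e ∈ E₁, z ∈ e) → (∃ e ∈ E₂, z ∈ e) → z = s ∨ z = t) :
      IsTTSP (E₁ ∪ E₂) s t

end FK

end Summit.CriticalPhenomena.PercolationContinuityZ3.Theorems
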